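import Summits.FinalStateConjecture.FinalStateConjecture.Theses.ZeroEnergyKerrOrBomb
import Summits.FinalStateConjecture.FinalStateConjecture.Theorems.ZeroEnergyKerrOrBombErgoregionBombModTEscapeEngineFree

/-!
# Crux `ErgoregionBombModT` (stmt-FinalStateConjecture-17838) — skeleton `SketchIdeator4` (zero-energy escape), v5

Line lead c7 (`prover-line-stmt-FinalStateConjecture-17838-c7-0`, 2026-08-17).  v4's three provable stubs LANDED in
cycle 1 of c7 — N1 `stub_hessianSublevelCompact` p163437, N3 `stub_logDivergenceAtFiniteEnd` p163421 (wave 1 workers),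
ENG″ `stub_escapeEngineFree` + the reduction `ergoregionBombModT_of_nullConvexFunction` p163760 (lead) — so the line is
at its TERMINAL shape:

  **`ErgoregionBombModT ⇐ ZF₀`, kernel-checked, UNCONDITIONAL** (no named fact; the Chruściel–Costa time function X of
  v3/v3.2 is idle: the escape function is its own yardstick).

The only stub is the open core ZF₀ `stub_zeroEnergyNullConvexFunction` (signature byte-identical since v3): for every
compact `S ⊆ ⟨⟨M_ext⟩⟩` of every telescope hole, an open `W ⊇ ⋃ₜ φₜ(S)` and a flow-invariant `F ∈ C²(W)` with
`Hess F_x(k, k) > 0` for `x ∈ S` and every non-zero zero-energy null `k`.  It is the pointwise zero-energy escape function —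
the certificate half of the Alexakis–Ionescu–Klainerman picture (Kerr-true by Carter's sign
`Kerr.hessAt_radius_neg_of_ksEnergy_eq_zero`; fails exactly at Killing light points, `noDocLightPoints_of_nullConvex`
p160463; through the X-free engine it yields universal zero-energy non-trapping mod `T` over every cage) — open in general,
crux-sized (`promote-stub`, Lines/SketchIdeator4-promote-stub.md).

History: v1/v2 (a1) engine with Killing-time yardstick — R1 p154600, R23 p154806, G12 p154804, G5 p155062, G3 p155599,
ENGINE + reduction p156340, kernel ⇒ NoDocLightPoints p155119; v3 (c6) KERNEL ⇐ X ∧ U1 ∧ U2 ∧ ZF₀ — U1 p159576,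
U2 p159698, assembly p160463, Literature fact X p160663; v4/v5 (c7) X eliminated — N1 p163437, N3 p163421, ENG″ p163760.

`lean check` (v5): the only sorry is `Holds.stub_zeroEnergyNullConvexFunction`; `ErgoregionBombModT_of` concludes the crux
BY NAME.
-/

noncomputable section

open Bundle Set Filter Function
open scoped Manifold Topology

set_option linter.dupNamespace false

namespace Summit.FinalStateConjecture.FinalStateConjecture.Cruxes.ErgoregionBombModT.ZeroEnergyEscape

open Literature.Geometry.Lorentzian

/-! ## The registered stub -/

namespace Holds

/-- **ZF₀ — the pointwise zero-energy escape function (OPEN core; the crux's whole residue).**  In the telescope of the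
crux (prefix verbatim), for every compact `S ⊆ ⟨⟨M_ext⟩⟩` there are an open `W ⊇ ⋃ₜ φₜ(S)` and `F ∈ C²(W)`, invariant
along the integral curves of `T` issued from `W`, with `Hess F_x(k, k) > 0` for `x ∈ S`, `g(k, k) = 0`, `g(k, T) = 0`,
`k ≠ 0`.  Vacuous where `T` is timelike; at an ergosurface point the condition on `k = T` reads `½⟨dF, d(g(T,T))⟩ > 0`
(so it fails exactly at Killing light points); inside the ergoregion it is strict convexity on the 2-cone of null directions
of the timelike hyperplane `T^⊥`.  Kerr-true (`F = e^{−μr}`, Carter's sign `Kerr.hessAt_radius_neg_of_ksEnergy_eq_zero`);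
open in general. -/
theorem stub_zeroEnergyNullConvexFunction :
    ∀ (𝓑 : Literature.Geometry.Lorentzian.StationaryAFBlackHole.{0}) [𝓑.metric.HasLeviCivita] [Literature.Geometry.Lorentzian.Kerr.Facts], 𝓑.metric.toPseudoRiemannianMetric.IsRicciFlat → 𝓑.IsIPlusRegular → (∀ p : 𝓑.carrier, p ∈ 𝓑.metric.chronologicalFuture 𝓑.timeOrientation 𝓑.Mext) → (∀ p ∈ 𝓑.doc, 𝓑.killing p ≠ 0) → SimplyConnectedSpace 𝓑.doc → ∀ (U : Set 𝓑.carrier) (K : Π x : 𝓑.carrier, TangentSpace (𝓡 4) x), IsOpen U → 𝓑.horizon ⊆ U → IsConnected 𝓑.horizon → ContMDiffOn (𝓡 4) ((𝓡 4).prod 𝓘(ℝ, Literature.Geometry.Lorentzian.E4)) ((⊤ : ℕ∞) : WithTop ℕ∞) (fun x ↦ (Bundle.TotalSpace.mk' Literature.Geometry.Lorentzian.E4 x (K x) : TangentBundle (𝓡 4) 𝓑.carrier)) U → (∀ x ∈ U, ∀ v w : TangentSpace (𝓡 4) x, 𝓑.metric.val x (𝓑.metric.leviCivita K x v) w + 𝓑.metric.val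 x v (𝓑.metric.leviCivita K x w) = 0) → (∀ x ∈ U, VectorField.mlieBracket (𝓡 4) 𝓑.killing K x = 0) → (∀ p ∈ 𝓑.horizon, K p ≠ 0) → (∀ γ : ℝ → 𝓑.carrier, IsMIntegralCurve γ K → γ 0 ∈ 𝓑.horizon → ∀ t, γ t ∈ 𝓑.horizon) → (∀ x ∈ U ∩ 𝓑.doc, 𝓑.metric.val x (K x) (K x) < 0) → (∃ S₀ : Set 𝓑.carrier, IsCompact S₀ ∧ S₀ ⊆ 𝓑.doc ∧ ∀ y ∈ 𝓑.doc, 0 ≤ 𝓑.metric.val y (𝓑.killing y) (𝓑.killing y) → y ∉ U → y ∈ Literature.Geometry.Lorentzian.stationaryOrbit 𝓑.killing S₀) → ∀ S : Set 𝓑.carrier, IsCompact S → S ⊆ 𝓑.doc → ∃ (W : Set 𝓑.carrier) (F : 𝓑.carrier → ℝ), IsOpen W ∧ Literature.Geometry.Lorentzian.stationaryOrbit 𝓑.killing S ⊆ W ∧ ContMDiffOn (𝓡 4) 𝓘(ℝ, ℝ) 2 F W ∧ (∀ σ : ℝ → 𝓑.carrier, IsMIntegralCurve σ 𝓑.killing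 → σ 0 ∈ W → ∀ t, F (σ t) = F (σ 0)) ∧ ∀ x ∈ S, ∀ k : TangentSpace (𝓡 4) x, 𝓑.metric.val x k k = 0 → 𝓑.metric.val x k (𝓑.killing x) = 0 → k ≠ 0 → 0 < 𝓑.metric.toPseudoRiemannianMetric.hessian F x k k := by
  sorry

end Holds

/-- Statement of ZF₀ (the open stub), by name. -/
def stub_zeroEnergyNullConvexFunction : Prop := type_of% Holds.stub_zeroEnergyNullConvexFunction

/-! ## Closed stubs of v1–v4, by name (landed theorems) -/

/-- ENG″ (v4), the X-free engine — LANDED p163760 (lead c7). -/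
def stub_escapeEngineFree : Prop :=
  type_of% Summit.FinalStateConjecture.FinalStateConjecture.Theorems.ErgoregionBombModT.stub_escapeEngineFree
/-- N1 (v4) — LANDED p163437 (wave 1 of lead c7). -/
def stub_hessianSublevelCompact : Prop :=
  type_of% Summit.FinalStateConjecture.FinalStateConjecture.Theorems.ErgoregionBombModT.stub_hessianSublevelCompact
/-- N3 (v4) — LANDED p163421 (wave 1 of lead c7). -/
def stub_logDivergenceAtFiniteEnd : Prop :=
  type_of% Summit.FinalStateConjecture.FinalStateConjecture.Theorems.ErgoregionBombModT.stub_logDivergenceAtFiniteEnd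
/-- U1 (v3) — landed p159576. -/
def stub_certificateTransport : Prop :=
  type_of% Summit.FinalStateConjecture.FinalStateConjecture.Theorems.ErgoregionBombModT.stub_certificateTransport
/-- U2 (v3) — landed p159698. -/
def stub_certificateCompactness : Prop :=
  type_of% Summit.FinalStateConjecture.FinalStateConjecture.Theorems.ErgoregionBombModT.stub_certificateCompactness
/-- R1 — landed p154600. -/
def stub_convexBoundedLine : Prop :=
  type_of% Summit.FinalStateConjecture.FinalStateConjecture.Theorems.ErgoregionBombModT.stub_convexBoundedLine
/-- R23 — landed p154806. -/
def stub_riccatiLogDivergence : Prop :=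
  type_of% Summit.FinalStateConjecture.FinalStateConjecture.Theorems.ErgoregionBombModT.stub_riccatiLogDivergence
/-- G12 — landed p154804. -/
def stub_calculusAlongGeodesic : Prop :=
  type_of% Summit.FinalStateConjecture.FinalStateConjecture.Theorems.ErgoregionBombModT.stub_calculusAlongGeodesic
/-- G5 — landed p155062. -/
def stub_nullFrequencyCompact : Prop :=
  type_of% Summit.FinalStateConjecture.FinalStateConjecture.Theorems.ErgoregionBombModT.stub_nullFrequencyCompact
/-- G3 — landed p155599. -/
def stub_escapeModFlow : Prop :=
  type_of% Summit.FinalStateConjecture.FinalStateConjecture.Theorems.ErgoregionBombModT.stub_escapeModFlow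
/-- ENGINE (v1, Killing-time yardstick) — landed p156340. -/
def stub_escapeEngine : Prop :=
  type_of% Summit.FinalStateConjecture.FinalStateConjecture.Theorems.ErgoregionBombModT.stub_escapeEngine

/-! ## Composition -/

/-- **`ErgoregionBombModT ⇐ ZF₀`** (concludes the crux BY NAME, by vacuity of its antecedent, with NO named fact): the
landed `ergoregionBombModT_of_nullConvexFunction` (p163760) = X-free engine `stub_escapeEngineFree` applied to the `(W, F)`
of ZF₀ on the cage of the compact `S` of the antecedent. -/
theorem ErgoregionBombModT_of (hZF : stub_zeroEnergyNullConvexFunction) :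
    Summit.FinalStateConjecture.FinalStateConjecture.Theses.ZeroEnergyKerrOrBomb.ErgoregionBombModT :=
  Summit.FinalStateConjecture.FinalStateConjecture.Theorems.ErgoregionBombModT.ergoregionBombModT_of_nullConvexFunction hZF

/-- D-0027 §3.3: the crux from the registered stub itself. -/
example : Summit.FinalStateConjecture.FinalStateConjecture.Theses.ZeroEnergyKerrOrBomb.ErgoregionBombModT :=
  ErgoregionBombModT_of Holds.stub_zeroEnergyNullConvexFunction

end Summit.FinalStateConjecture.FinalStateConjecture.Cruxes.ErgoregionBombModT.ZeroEnergyEscape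

end
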